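import Mathlib
import HarnessLib
import Literature.Computability.AlgebraicComplexity.ArithCircuit
import Literature.Computability.AlgebraicComplexity.CircuitDepth
import Literature.Computability.AlgebraicComplexity.CircuitGateSemantics
import Literature.Computability.AlgebraicComplexity.ArithCircuitProofs
import Literature.Computability.AlgebraicComplexity.ArithCircuitProjections
import Literature.Computability.AlgebraicComplexity.ArithCircuitDegreeBound
import Literature.Probability.Percolation.SlabGluing
import Literature.Computability.AlgebraicComplexity.StandardFamilies
import Literature.Computability.AlgebraicComplexity.DeterminantalIdealComplexityDescent
import Literature.Computability.AlgebraicComplexity.CircuitConstantCount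
import Literature.Computability.AlgebraicComplexity.ZModCircuitIntegerCodes
import Literature.Computability.AlgebraicComplexity.RealTauConjectureDepthFour
import Literature.Computability.AlgebraicComplexity.AndrewsForbes2022BorderComposition
import Literature.Computability.AlgebraicComplexity.BrentFormulaDepthCircuits
import Literature.Computability.AlgebraicComplexity.ValiantConjectureEquivProofs
import Summits.ValiantsHypothesis.Statement
import Summits.ValiantsHypothesis.ValiantsHypothesis.Theorems.SuccinctLiftAlgebraicConstants
import Summits.ValiantsHypothesis.ValiantsHypothesis.Theorems.SuccinctLiftIntegerAdvice
import Summits.ValiantsHypothesis.ValiantsHypothesis.Theorems.SuccinctLiftFiniteFields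
import Summits.ValiantsHypothesis.ValiantsHypothesis.Theorems.DepthWindowBinarisation


/-!
# Succinct lift — w8a: generic skeletons of bounded-wire circuits and a Lefschetz lemma

Route `route-ValiantsHypothesis-SuccinctLift` (lens 2, constants axis), generation 6, first of
two files.  Infrastructure for the KERNEL CHARACTERISTIC TRANSFER proved in
`SuccinctLiftLefschetz.lean`:

* §1 circuit bookkeeping in the unbounded-fan-in model: `trimJunk` keeps the product-depth
  (`productDepth_trimJunk`), hence a NORMAL FORM with the same value, no larger product-depth, no
  more wires, well formed and with at most as many gates as wires
  (`exists_wellFormed_size_le_edgeSize`); a plain change of constants keeps product-depth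
  (`productDepth_mapConsts'`) and reference ranges (`refsLT_mapConsts'`); a circuit with `e` wires
  carries `≤ 2e + 1` constants (`length_consts_le_edgeSize`); over a finite alphabet and finitely
  many variables there are FINITELY many skeletons of bounded size, fan-in and reference range
  (`finite_skeletons_of_fanIn_le` — BCS's finitely many "types" of a computation).
* §2 the algebra of the Lefschetz step (`exists_ringHom_complex_of_charSpread`): an ideal
  `I ⊆ ℤ[y_1, …, y_M]` killed by homomorphisms into fields in which any prescribed integer `N ≠ 0`
  survives is killed by a homomorphism into `ℂ` (no non-zero integer lies in `I`; localise to
  `ℚ[y]`; Zariski's lemma; embed the residue number field into `ℂ`).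

References: [BurgisserClausenShokrollahi1997] §4.1 (autarky), §9.1 (generic computations,
Thm. (9.13)); [Burgisser2000] Def. 2.1, §4.1; [LimayeSrinivasanTavenas2021] §2 (product-depth,
wires).
-/

noncomputable section

namespace Summit.ValiantsHypothesis.ValiantsHypothesis.Theorems.SuccinctLift

open Literature.Computability.AlgebraicComplexity MvPolynomial

universe u v

/-! ### §1 Circuit bookkeeping: trimming junk keeps product-depth; plain change of constants -/

namespace Bookkeeping

open ArithCircuit

variable {k k' : Type u} {σ : Type v}

/-- The product weight of a gate is unchanged by truncating its operands. [cite: Burgisser2000, Def. 2.1] -/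
theorem prodWeight_truncate [Zero k] (n : ℕ) (g : Gate k σ) :
    prodWeight (g.truncate n) = prodWeight g := by
  cases g <;> simp [prodWeight, Gate.truncate, Gate.isProd]

/-- Truncating gate `i` at `i`, for every `i`, does not change the list of product-depths (a junk
reference and the constant `0` both have depth `0`). [cite: Burgisser2000, Def. 2.1] -/
theorem gateWDepths_mapIdx_truncate [Zero k] (gs : List (Gate k σ)) :
    gateWDepths prodWeight (gs.mapIdx fun i g => g.truncate i) = gateWDepths prodWeight gs := by
  induction gs using List.reverseRecOn with
  | nil => rfl
  | append_singleton gs g ih =>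
    rw [List.mapIdx_concat, gateWDepths_append_singleton, gateWDepths_append_singleton, ih]
    have hlen : (gateWDepths prodWeight gs).length = gs.length := gateWDepths_length _ gs
    have h2 : (g.truncate gs.length).args.map (Operand.depthIn (gateWDepths prodWeight gs)) =
        g.args.map (Operand.depthIn (gateWDepths prodWeight gs)) := by
      rw [Gate.args_truncate, List.map_map]
      refine List.map_congr_left fun u _ => ?_
      have := Operand.depthIn_truncate_append (k := k) (gateWDepths prodWeight gs) [] u
      rwa [List.append_nil, hlen] at this
    rw [prodWeight_truncate, h2]

/-- `trimJunk` keeps the product-depth. [cite: Burgisser2000, Def. 2.1] -/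
theorem productDepth_trimJunk [Zero k] (P : ArithCircuit k σ) :
    P.trimJunk.productDepth = P.productDepth := by
  rw [productDepth_eq_wdepth_prodWeight, productDepth_eq_wdepth_prodWeight]
  have h := Operand.depthIn_truncate_append (k := k) (gateWDepths prodWeight P.gates) [] P.output
  rw [List.append_nil, gateWDepths_length] at h
  change (P.output.truncate P.gates.length).depthIn
      (gateWDepths prodWeight (P.gates.mapIdx fun i g => g.truncate i)) = _
  rw [gateWDepths_mapIdx_truncate, h]
  rfl

/-- **Normal form**: same value, no larger product-depth, no more wires, well formed, and number of
gates at most the number of wires. [cite: Burgisser2000, Def. 2.1] -/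
theorem exists_wellFormed_size_le_edgeSize [CommSemiring k] (C : ArithCircuit k σ) :
    ∃ N : ArithCircuit k σ, N.WellFormed ∧ N.eval = C.eval ∧ N.productDepth ≤ C.productDepth ∧
      N.edgeSize ≤ C.edgeSize ∧ N.size ≤ C.edgeSize := by
  obtain ⟨P', hev, hpd, hes, hsz⟩ := exists_size_le_edgeSize C
  refine ⟨P'.trimJunk, wellFormed_trimJunk P', ?_, ?_, ?_, ?_⟩
  · rw [eval_trimJunk, hev]
  · rw [productDepth_trimJunk]; exact hpd
  · rw [edgeSize_trimJunk]; exact hes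
  · rw [size_trimJunk]; exact hsz.trans hes

/-- Functoriality of `Operand.map` (plain maps). [folklore] -/
theorem Operand.map_map' (φ : k → k') {k'' : Type*} (ψ : k' → k'') (u : Operand k σ) :
    (u.map φ).map ψ = u.map (ψ ∘ φ) := by
  cases u <;> rfl

/-- Functoriality of `Gate.map` (plain maps). [folklore] -/
theorem Gate.map_map' (φ : k → k') {k'' : Type*} (ψ : k' → k'') (g : Gate k σ) :
    (g.map φ).map ψ = g.map (ψ ∘ φ) := by
  cases g <;> simp [Gate.map, List.map_map, Function.comp_def, Operand.map_map']

/-- Functoriality of `mapConsts` (plain maps). [folklore] -/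
theorem mapConsts_mapConsts' (φ : k → k') {k'' : Type*} (ψ : k' → k'') (P : ArithCircuit k σ) :
    (P.mapConsts φ).mapConsts ψ = P.mapConsts (ψ ∘ φ) := by
  simp [mapConsts, List.map_map, Function.comp_def, Gate.map_map', Operand.map_map']

/-- `Gate.map` keeps the product weight. [folklore] -/
theorem prodWeight_map' (φ : k → k') (g : Gate k σ) : prodWeight (g.map φ) = prodWeight g := by
  cases g <;> rfl

/-- A plain change of constants keeps the list of product-depths. [folklore] -/
theorem gateWDepths_map_map' (φ : k → k') (gs : List (Gate k σ)) :
    gateWDepths prodWeight (gs.map (Gate.map φ)) = gateWDepths prodWeight gs := by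
  induction gs using List.reverseRecOn with
  | nil => rfl
  | append_singleton gs g ih =>
    rw [List.map_append, List.map_singleton, gateWDepths_append_singleton,
      gateWDepths_append_singleton, ih]
    have h2 : ((g.map φ).args.map (Operand.depthIn (gateWDepths prodWeight gs))) =
        g.args.map (Operand.depthIn (gateWDepths prodWeight gs)) := by
      rw [Gate.args_mapCoeff, List.map_map]
      exact List.map_congr_left fun u _ => Operand.depthIn_mapCoeff φ _ u
    rw [prodWeight_map', h2]

/-- **A plain change of constants keeps the product-depth** (`mapConsts` along any function, not
only ring homomorphisms). [cite: Burgisser2000, §4.1] -/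
theorem productDepth_mapConsts' (φ : k → k') (P : ArithCircuit k σ) :
    (P.mapConsts φ).productDepth = P.productDepth := by
  rw [productDepth_eq_wdepth_prodWeight, productDepth_eq_wdepth_prodWeight]
  change (P.output.map φ).depthIn (gateWDepths prodWeight (P.gates.map (Gate.map φ))) = _
  rw [gateWDepths_map_map', Operand.depthIn_mapCoeff]
  rfl

/-- `Operand.map` preserves the range of gate references. [folklore] -/
theorem Operand.refsBelow_map' (φ : k → k') {n : ℕ} {u : Operand k σ} (h : u.RefsBelow n) :
    (u.map φ).RefsBelow n := by
  cases u with
  | var i => trivial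
  | const c => trivial
  | gate j => exact h

/-- `mapConsts` preserves `RefsLT`. [folklore] -/
theorem refsLT_mapConsts' (φ : k → k') {s : ℕ} {P : ArithCircuit k σ} (h : RefsLT s P) :
    RefsLT s (P.mapConsts φ) := by
  refine ⟨fun g hg u hu => ?_, Operand.refsBelow_map' φ h.2⟩
  simp only [mapConsts, List.mem_map] at hg
  obtain ⟨g₀, hg₀, rfl⟩ := hg
  rw [Gate.args_mapCoeff, List.mem_map] at hu
  obtain ⟨u₀, hu₀, rfl⟩ := hu
  exact Operand.refsBelow_map' φ (h.1 g₀ hg₀ u₀ hu₀)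

/-- `mapConsts` keeps every fan-in. [folklore] -/
theorem forall_fanIn_le_mapConsts (φ : k → k') {r : ℕ} {P : ArithCircuit k σ}
    (h : ∀ g ∈ P.gates, g.fanIn ≤ r) : ∀ g ∈ (P.mapConsts φ).gates, g.fanIn ≤ r := by
  intro g hg
  simp only [mapConsts, List.mem_map] at hg
  obtain ⟨g₀, hg₀, rfl⟩ := hg
  rw [Gate.fanIn_map]
  exact h g₀ hg₀

/-- **A circuit with `e` wires carries at most `2e + 1` constants** (one coefficient and at most one
constant operand per wire of a sum gate, one constant operand per wire of a product gate, and the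
output). [cite: BurgisserClausenShokrollahi1997, §9.1] -/
theorem length_consts_le_edgeSize (P : ArithCircuit k σ) : P.consts.length ≤ 2 * P.edgeSize + 1 := by
  have key : ∀ gs : List (Gate k σ),
      (gs.flatMap Gate.consts).length ≤ 2 * (gs.map Gate.fanIn).sum := by
    intro gs
    induction gs with
    | nil => simp
    | cons g gs ih =>
      rw [List.flatMap_cons, List.length_append, List.map_cons, List.sum_cons]
      have := Gate.length_consts_le g
      omega
  have hg := key P.gates
  have hout := Operand.length_consts_le P.output
  unfold consts edgeSize
  rw [List.length_append]
  omega

/-- **Finitely many skeletons** of size `≤ s`, fan-in `≤ r`, references below `s`, over the finite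
alphabet `Fin T` in finitely many variables (BCS's finitely many "types" of a computation,
unbounded fan-in version). [cite: BurgisserClausenShokrollahi1997, Thm. (9.13)] -/
theorem finite_skeletons_of_fanIn_le [Finite σ] (s r T : ℕ) :
    {sk : ArithCircuit (Fin T) σ | sk.size ≤ s ∧ (∀ g ∈ sk.gates, g.fanIn ≤ r) ∧ RefsLT s sk}.Finite := by
  -- operands with references below `s`
  let O : Set (Operand (Fin T) σ) := {u | u.RefsBelow s}
  have hO : O.Finite := by
    refine ((Set.finite_range Operand.var).union ((Set.finite_range Operand.const).union
      ((Set.finite_lt_nat s).image Operand.gate))).subset fun u hu => ?_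
    cases u with
    | var i => exact Or.inl ⟨i, rfl⟩
    | const c => exact Or.inr (Or.inl ⟨c, rfl⟩)
    | gate j => exact Or.inr (Or.inr ⟨j, hu, rfl⟩)
  -- gates of fan-in ≤ r with operands in `O`
  let G : Set (Gate (Fin T) σ) := {g | g.fanIn ≤ r ∧ ∀ u ∈ g.args, u ∈ O}
  have hA : {l : List (Fin T × Operand (Fin T) σ) | l.length ≤ r ∧
      ∀ a ∈ l, a ∈ (Set.univ : Set (Fin T)) ×ˢ O}.Finite :=
    Literature.Probability.Percolation.finite_setOf_length_le ((Set.finite_univ).prod hO) r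
  have hB : {l : List (Operand (Fin T) σ) | l.length ≤ r ∧ ∀ u ∈ l, u ∈ O}.Finite :=
    Literature.Probability.Percolation.finite_setOf_length_le hO r
  have hG : G.Finite := by
    refine ((hA.image Gate.sum).union (hB.image Gate.prod)).subset fun g hg => ?_
    obtain ⟨hfan, hops⟩ := hg
    cases g with
    | sum args =>
      refine Or.inl ⟨args, ⟨?_, fun a ha => ⟨Set.mem_univ _, hops a.2 ?_⟩⟩, rfl⟩
      · simpa [Gate.fanIn, Gate.args] using hfan
      · simp only [Gate.args, List.mem_map]
        exact ⟨a, ha, rfl⟩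
    | prod args =>
      refine Or.inr ⟨args, ⟨?_, fun u hu => hops u ?_⟩, rfl⟩
      · simpa [Gate.fanIn, Gate.args] using hfan
      · simpa [Gate.args] using hu
  have hC : {l : List (Gate (Fin T) σ) | l.length ≤ s ∧ ∀ g ∈ l, g ∈ G}.Finite :=
    Literature.Probability.Percolation.finite_setOf_length_le hG s
  refine ((hC.prod hO).image fun q => (⟨q.1, q.2⟩ : ArithCircuit (Fin T) σ)).subset
    fun sk hsk => ?_
  obtain ⟨hsize, hfan, hrefs⟩ := hsk
  exact ⟨(sk.gates, sk.output), ⟨⟨hsize, fun g hg => ⟨hfan g hg, fun u hu => hrefs.1 g hg u hu⟩⟩,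
    hrefs.2⟩, rfl⟩

end Bookkeeping

/-! ### §2 Algebra: an ideal of `ℤ[y]` dying in unboundedly many characteristics dies in `ℂ` -/

/-- **Lefschetz principle for a finitely generated ideal.** If an ideal `I ⊆ ℤ[y_1, …, y_M]` is
killed by ring homomorphisms into fields in which any prescribed non-zero integer `N` survives,
then `I` is killed by a ring homomorphism into `ℂ`.  (No non-zero integer lies in `I`; so
`I · ℚ[y] ≠ ℚ[y]` by the localisation `ℚ[y] = (ℤ ∖ 0)⁻¹ ℤ[y]`; a maximal ideal above it has a
residue field finite over `ℚ` by Zariski's lemma, which embeds into the algebraically closed `ℂ`.)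
[cite: BurgisserClausenShokrollahi1997, §4.1] -/
theorem exists_ringHom_complex_of_charSpread {M : ℕ} (I : Ideal (MvPolynomial (Fin M) ℤ))
    (h : ∀ N : ℕ, N ≠ 0 → ∃ (F : Type) (_ : Field F) (ψ : MvPolynomial (Fin M) ℤ →+* F),
      (N : F) ≠ 0 ∧ ∀ x ∈ I, ψ x = 0) :
    ∃ θ : MvPolynomial (Fin M) ℤ →+* ℂ, ∀ x ∈ I, θ x = 0 := by
  classical
  -- (1) `I` contains no nonzero integer.
  have hint : ∀ N : ℤ, N ≠ 0 → (C N : MvPolynomial (Fin M) ℤ) ∉ I := by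
    intro N hN hNI
    obtain ⟨F, _, ψ, hNF, hψ⟩ := h N.natAbs (Int.natAbs_ne_zero.mpr hN)
    have h0 : (N : F) = 0 := by
      rw [← eq_intCast (ψ.comp C) N, RingHom.comp_apply]
      exact hψ _ hNI
    apply hNF
    have hcast : ((N.natAbs : ℤ) : F) = (N.natAbs : F) := Int.cast_natCast _
    rcases Int.natAbs_eq N with hN' | hN'
    · rw [← hcast, ← hN']; exact h0
    · rw [← hcast, ← neg_eq_zero, ← Int.cast_neg, ← hN']; exact h0
  -- (2) the extension of `I` to `ℚ[y]` is a proper ideal.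
  let A := MvPolynomial (Fin M) ℤ
  let B := MvPolynomial (Fin M) ℚ
  letI : Algebra A B := MvPolynomial.algebraMvPolynomial
  haveI : IsLocalization ((nonZeroDivisors ℤ).map (C : ℤ →+* A)) B :=
    MvPolynomial.isLocalization (nonZeroDivisors ℤ) ℚ
  have hinj : Function.Injective (algebraMap A B) := by
    rw [MvPolynomial.algebraMap_def]
    exact MvPolynomial.map_injective _ (algebraMap ℤ ℚ).injective_int
  have hJ : Ideal.map (algebraMap A B) I ≠ ⊤ := by
    intro htop
    have h1 : (1 : B) ∈ Ideal.map (algebraMap A B) I := by rw [htop]; exact Submodule.mem_top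
    obtain ⟨⟨⟨a, ha⟩, ⟨m, hm⟩⟩, hx⟩ :=
      (IsLocalization.mem_map_algebraMap_iff ((nonZeroDivisors ℤ).map (C : ℤ →+* A)) B).mp h1
    obtain ⟨N, hN, hNm⟩ := Submonoid.mem_map.mp hm
    have hx' : algebraMap A B m = algebraMap A B a := by
      have := hx; simp only [one_mul] at this; exact this
    have hma : m = a := hinj hx'
    refine hint N (nonZeroDivisors.ne_zero hN) ?_
    rw [hNm, hma]; exact ha
  -- (3) Zariski: a maximal ideal above it has a residue field finite over `ℚ`, embedding in `ℂ`.
  obtain ⟨𝔪, h𝔪, hJ𝔪⟩ := Ideal.exists_le_maximal _ hJ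
  let L := B ⧸ 𝔪
  letI : Field L := Ideal.Quotient.field 𝔪
  haveI : Algebra.FiniteType ℚ L :=
    Algebra.FiniteType.of_surjective (Ideal.Quotient.mkₐ ℚ 𝔪) (Ideal.Quotient.mkₐ_surjective ℚ 𝔪)
  haveI : Module.Finite ℚ L := finite_of_finite_type_of_isJacobsonRing ℚ L
  haveI : Algebra.IsAlgebraic ℚ L := Algebra.IsAlgebraic.of_finite ℚ L
  let e : L →ₐ[ℚ] ℂ := IsAlgClosed.lift
  refine ⟨e.toRingHom.comp ((Ideal.Quotient.mk 𝔪).comp (algebraMap A B)), fun x hx => ?_⟩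
  have hxm : algebraMap A B x ∈ 𝔪 := hJ𝔪 (Ideal.mem_map_of_mem _ hx)
  simp only [RingHom.comp_apply, Ideal.Quotient.eq_zero_iff_mem.mpr hxm, map_zero]

end Summit.ValiantsHypothesis.ValiantsHypothesis.Theorems.SuccinctLift

end
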